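import Literature.Analysis.FluidPDE.CriticalRegularity
import Literature.Analysis.FunctionSpaces.BMOInvProofs
import HarnessLib

/-!
# Finiteness of the vector `BMO⁻¹` norm (proofs)

Sibling proof file of `Literature/Analysis/FluidPDE/CriticalRegularity.lean` (section
`KochTataru`), on top of `Literature/Analysis/FunctionSpaces/BMOInvProofs.lean` (the scalar
discharge `Literature.Analysis.FunctionSpaces.MemBMOInv.eBMOInvNorm_lt_top_holds` and the
linearity lemmas for `‖·‖_*`). Everything here is proved. This file discharges the named fact

* `Literature.Analysis.FunctionSpaces.MemBMOInvVec.eBMOInvNormVec_lt_top` — a vector field in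
  `BMO⁻¹(E; E)` (every component `⟪u₀, v⟫ ∈ BMO⁻¹`, `Literature.Analysis.FunctionSpaces.MemBMOInvVec`)
  has finite vector `BMO⁻¹` norm `sup_{‖v‖ ≤ 1} ‖⟪u₀, v⟫‖_{BMO⁻¹}`
  (`Literature.Analysis.FluidPDE.eBMOInvNormVec`): theorem
  `Literature.Analysis.FunctionSpaces.MemBMOInvVec.eBMOInvNormVec_lt_top_holds`.

Source: H. Koch, D. Tataru, *Well-posedness for the Navier–Stokes equations*, Adv. Math. 157
(2001), §1 (p. 24: "Clearly the divergence of a vector field with components in `BMO` is in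
`BMO⁻¹`"; Theorem 1; Theorem 2: the data space is the vector `BMO⁻¹`, normed componentwise) and
§4, first paragraph of the proof of Theorem 1 (`|B|⁻¹ ∫_Q ∑ᵢ |∂ᵢ vⁱ|² ≤ ∑ᵢ ‖fⁱ‖²_{BMO}`, hence
`∇ · f ∈ BMO⁻¹` with norm controlled by the components).

## Proof

With the divergence-form definitions of this library the content is finite-dimensional linear
algebra. Weak divergence representations are linear
(`Literature.Analysis.FunctionSpaces.HasWeakDivergenceRepresentation.const_smul`, `.sum`, on top of the tree's `.add`),
and the vector `BMO` seminorm is subadditive and absolutely homogeneous on linear combinations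
(`Literature.Analysis.FluidPDE.eBMOSeminormVec_sum_smul_le`, from `eBMOSeminorm_sum_le'` and
`eBMOSeminorm_const_mul_le`). Fix an orthonormal basis `(bᵢ)` and representations
`⟪u₀, bᵢ⟫ = div Φᵢ` with `BMO` components. For `‖v‖ ≤ 1`,
`⟪u₀, v⟫ = ∑ᵢ ⟪bᵢ, v⟫ ⟪u₀, bᵢ⟫ = div (∑ᵢ ⟪bᵢ, v⟫ Φᵢ)` with `|⟪bᵢ, v⟫| ≤ 1`, whence
`‖⟪u₀, v⟫‖_{BMO⁻¹} ≤ ∑ᵢ |⟪bᵢ, v⟫| · sup_{‖w‖ ≤ 1} ‖⟪Φᵢ, w⟫‖_* ≤ ∑ᵢ sup_{‖w‖ ≤ 1} ‖⟪Φᵢ, w⟫‖_*`,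
a bound uniform in `v` and finite by `Literature.Analysis.FunctionSpaces.eBMOSeminormVec_lt_top`.

## References

* H. Koch, D. Tataru, *Well-posedness for the Navier–Stokes equations*, Adv. Math. 157 (2001),
  22–35, doi:10.1006/aima.2000.1937, §1 (Theorems 1, 2) and §4 (proof of Theorem 1).
  [KochTataruAdvMath2001] (held: `paper:doi-10-1006-aima-2000-1937`, pp. 3 and 10 of the held
  copy.)
* E. M. Stein, *Harmonic Analysis* (1993), Ch. IV §1.1 (`‖·‖_*` is a seminorm). [SteinHA1993]
-/

noncomputable section

open MeasureTheory Metric Filter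
open scoped ENNReal NNReal RealInnerProductSpace

namespace Literature.Analysis.FluidPDE

section KochTataru

variable {E : Type*} [NormedAddCommGroup E] [InnerProductSpace ℝ E] [FiniteDimensional ℝ E]
  [MeasurableSpace E] [BorelSpace E]

/-- Weak divergence representations are homogeneous: `u = div Φ` weakly implies
`c u = div (c Φ)` weakly for every constant `c : ℝ` (linearity of the distributional divergence:
both sides of the defining identity `∫ u φ = -∫ ⟪Φ, ∇φ⟫` are multiplied by `c`). Deliberate
dot-notation extension of `Literature.Analysis.FunctionSpaces.HasWeakDivergenceRepresentation`
(defined in `FunctionSpaces/BMO.lean`). [folklore] -/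
theorem _root_.Literature.Analysis.FunctionSpaces.HasWeakDivergenceRepresentation.const_smul
    {u : E → ℝ} {Φ : E → E} (hu : FunctionSpaces.HasWeakDivergenceRepresentation u Φ) (c : ℝ) :
    FunctionSpaces.HasWeakDivergenceRepresentation (c • u) (c • Φ) where
  locallyIntegrable := hu.locallyIntegrable.smul c
  locallyIntegrable_field := hu.locallyIntegrable_field.smul c
  integral_mul_eq φ hφ := by
    have h1 : (fun x => (c • u) x * φ x) = fun x => c * (u x * φ x) := by
      funext x
      simp only [Pi.smul_apply, smul_eq_mul, mul_assoc]
    have h2 : (fun x => ⟪(c • Φ) x, gradient φ x⟫) = fun x => c * ⟪Φ x, gradient φ x⟫ := by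
      funext x
      rw [Pi.smul_apply, real_inner_smul_left]
    rw [h1, h2, integral_const_mul, integral_const_mul, hu.integral_mul_eq φ hφ, mul_neg]

/-- Weak divergence representations of a finite family add up: `uᵢ = div Φᵢ` weakly for
`i ∈ s` implies `∑ᵢ uᵢ = div (∑ᵢ Φᵢ)` weakly (iterate
`Literature.Analysis.FunctionSpaces.HasWeakDivergenceRepresentation.add` from the zero representation). Deliberate
dot-notation extension of `Literature.Analysis.FunctionSpaces.HasWeakDivergenceRepresentation`. [folklore] -/
theorem _root_.Literature.Analysis.FunctionSpaces.HasWeakDivergenceRepresentation.sum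
    {ι : Type*} {s : Finset ι} {u : ι → E → ℝ} {Φ : ι → E → E}
    (h : ∀ i ∈ s, FunctionSpaces.HasWeakDivergenceRepresentation (u i) (Φ i)) :
    FunctionSpaces.HasWeakDivergenceRepresentation (∑ i ∈ s, u i) (∑ i ∈ s, Φ i) := by
  classical
  induction s using Finset.induction_on with
  | empty => simpa using FunctionSpaces.hasWeakDivergenceRepresentation_zero
  | insert a s ha ih =>
    rw [Finset.sum_insert ha, Finset.sum_insert ha]
    exact (h a (Finset.mem_insert_self a s)).add
      (ih fun i hi => h i (Finset.mem_insert_of_mem hi))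

/-- **Subadditivity and homogeneity of the vector `BMO` seminorm on linear combinations**: for
locally integrable fields `Φᵢ` and real coefficients `cᵢ`,
`sup_{‖w‖ ≤ 1} ‖⟪∑ᵢ cᵢ Φᵢ, w⟫‖_* ≤ ∑ᵢ |cᵢ| sup_{‖w‖ ≤ 1} ‖⟪Φᵢ, w⟫‖_*` (Stein, *Harmonic Analysis*
IV.1.1: `‖·‖_*` is a seminorm; componentwise `⟪∑ᵢ cᵢ Φᵢ, w⟫ = ∑ᵢ cᵢ ⟪Φᵢ, w⟫`, then
`eBMOSeminorm_sum_le'` and `eBMOSeminorm_const_mul_le`). [cite: SteinHA1993, IV.1.1] -/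
theorem eBMOSeminormVec_sum_smul_le {ι : Type*} {s : Finset ι} {c : ι → ℝ} {Φ : ι → E → E}
    (hΦ : ∀ i ∈ s, LocallyIntegrable (Φ i)) :
    FunctionSpaces.eBMOSeminormVec (∑ i ∈ s, c i • Φ i) ≤
      ∑ i ∈ s, ‖c i‖ₑ * FunctionSpaces.eBMOSeminormVec (Φ i) := by
  refine iSup₂_le fun w hw => ?_
  have hrepr : (fun x => ⟪(∑ i ∈ s, c i • Φ i) x, w⟫) = fun x => ∑ i ∈ s, c i * ⟪Φ i x, w⟫ := by
    funext x
    simp only [Finset.sum_apply, Pi.smul_apply, sum_inner, real_inner_smul_left]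
  have hli : ∀ i ∈ s, LocallyIntegrable (fun x => c i * ⟪Φ i x, w⟫) := fun i hi => by
    have h₁ : LocallyIntegrable (fun x => ⟪Φ i x, w⟫) := fun x => by
      obtain ⟨t, ht, hint⟩ := hΦ i hi x
      exact ⟨t, ht, hint.inner_const w⟩
    simpa only [Pi.smul_def, smul_eq_mul] using h₁.smul (c i)
  have key : ∀ i, FunctionSpaces.eBMOSeminorm (fun x => ⟪Φ i x, w⟫) ≤
      FunctionSpaces.eBMOSeminormVec (Φ i) := fun i =>
    le_iSup_of_le w (le_iSup_of_le hw le_rfl)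
  have h₁ : FunctionSpaces.eBMOSeminorm (fun x => ∑ i ∈ s, c i * ⟪Φ i x, w⟫) ≤
      ∑ i ∈ s, FunctionSpaces.eBMOSeminorm (fun x => c i * ⟪Φ i x, w⟫) :=
    FunctionSpaces.eBMOSeminorm_sum_le' hli
  have h₂ : ∑ i ∈ s, FunctionSpaces.eBMOSeminorm (fun x => c i * ⟪Φ i x, w⟫) ≤
      ∑ i ∈ s, ‖c i‖ₑ * FunctionSpaces.eBMOSeminorm (fun x => ⟪Φ i x, w⟫) :=
    Finset.sum_le_sum fun i _ => FunctionSpaces.eBMOSeminorm_const_mul_le _ _ _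
  have h₃ : ∑ i ∈ s, ‖c i‖ₑ * FunctionSpaces.eBMOSeminorm (fun x => ⟪Φ i x, w⟫) ≤
      ∑ i ∈ s, ‖c i‖ₑ * FunctionSpaces.eBMOSeminormVec (Φ i) :=
    Finset.sum_le_sum fun i _ => mul_le_mul_right (key i) _
  rw [hrepr]
  exact h₁.trans (h₂.trans h₃)

/-- **A field in `BMO⁻¹(E; E)` has finite vector `BMO⁻¹` norm** (discharge of the named fact
`Literature.Analysis.FunctionSpaces.MemBMOInvVec.eBMOInvNormVec_lt_top`; Koch–Tataru, Adv. Math. 157 (2001), §1 with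
Theorem 1 — "the divergence of a vector field with components in `BMO` is in `BMO⁻¹`",
quantified in §4, first paragraph of the proof of Theorem 1 — and Theorem 2, whose data space is
the vector `BMO⁻¹` normed componentwise). In an orthonormal basis `(bᵢ)` write
`⟪u₀, bᵢ⟫ = div Φᵢ` with `BMO` components; for `‖v‖ ≤ 1`,
`⟪u₀, v⟫ = ∑ᵢ ⟪bᵢ, v⟫ ⟪u₀, bᵢ⟫ = div (∑ᵢ ⟪bᵢ, v⟫ Φᵢ)` with `|⟪bᵢ, v⟫| ≤ 1`, so
`‖⟪u₀, v⟫‖_{BMO⁻¹} ≤ ∑ᵢ sup_{‖w‖ ≤ 1} ‖⟪Φᵢ, w⟫‖_*`, uniformly in `v` and finite by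
`Literature.Analysis.FunctionSpaces.eBMOSeminormVec_lt_top`. Deliberate dot-notation extension of
`Literature.Analysis.FunctionSpaces.MemBMOInvVec`, mirroring the name of the fact. [cite: KochTataruAdvMath2001, Theorem 1] -/
theorem _root_.Literature.Analysis.FunctionSpaces.MemBMOInvVec.eBMOInvNormVec_lt_top_holds :
    FunctionSpaces.MemBMOInvVec.eBMOInvNormVec_lt_top (E := E) := by
  intro u₀ hu
  -- an (opaque) orthonormal basis of `E`
  obtain ⟨b⟩ : Nonempty (OrthonormalBasis (Fin (Module.finrank ℝ E)) ℝ E) :=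
    ⟨stdOrthonormalBasis ℝ E⟩
  -- divergence representations of the coordinate components `⟪u₀, bᵢ⟫`
  have hex : ∀ i, ∃ Φ : E → E, (∀ w : E, FunctionSpaces.MemBMO (fun x => ⟪Φ x, w⟫)) ∧
      FunctionSpaces.HasWeakDivergenceRepresentation (fun x => ⟪u₀ x, b i⟫) Φ := fun i => hu (b i)
  choose Φ hΦ hrep using hex
  have hΦli : ∀ i, LocallyIntegrable (Φ i) := fun i => (hrep i).locallyIntegrable_field
  -- the uniform bound `‖⟪u₀, v⟫‖_{BMO⁻¹} ≤ ∑ᵢ ‖Φᵢ‖_{BMO}` for `‖v‖ ≤ 1`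
  have hbound : ∀ v : E, ‖v‖ ≤ 1 → FunctionSpaces.eBMOInvNorm (fun x => ⟪u₀ x, v⟫) ≤
      ∑ i, FunctionSpaces.eBMOSeminormVec (Φ i) := by
    intro v hv
    -- expand `v` in the orthonormal basis `b`
    have hrepr : (fun x => ⟪u₀ x, v⟫) = ∑ i, ⟪b i, v⟫ • fun x => ⟪u₀ x, b i⟫ := by
      funext x
      conv_lhs => rw [← b.sum_repr' v]
      simp only [inner_sum, real_inner_smul_right, Finset.sum_apply, Pi.smul_apply, smul_eq_mul]
    -- the coefficients are at most `1` in absolute value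
    have hcoef : ∀ i, ‖⟪b i, v⟫‖ₑ ≤ 1 := fun i => by
      rw [Real.enorm_eq_ofReal_abs, ENNReal.ofReal_le_one]
      calc |⟪b i, v⟫| ≤ ‖b i‖ * ‖v‖ := abs_real_inner_le_norm _ _
        _ ≤ 1 * 1 := by
            gcongr
            exact (b.orthonormal.1 i).le
        _ = 1 := one_mul 1
    -- `⟪u₀, v⟫ = div (∑ᵢ ⟪bᵢ, v⟫ Φᵢ)` weakly
    have hΨ : FunctionSpaces.HasWeakDivergenceRepresentation (fun x => ⟪u₀ x, v⟫)
        (∑ i, ⟪b i, v⟫ • Φ i) := by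
      rw [hrepr]
      exact FunctionSpaces.HasWeakDivergenceRepresentation.sum fun i _ =>
        (hrep i).const_smul ⟪b i, v⟫
    have h₁ : FunctionSpaces.eBMOInvNorm (fun x => ⟪u₀ x, v⟫) ≤
        FunctionSpaces.eBMOSeminormVec (∑ i, ⟪b i, v⟫ • Φ i) := iInf₂_le (∑ i, ⟪b i, v⟫ • Φ i) hΨ
    have h₂ : FunctionSpaces.eBMOSeminormVec (∑ i, ⟪b i, v⟫ • Φ i) ≤
        ∑ i, ‖⟪b i, v⟫‖ₑ * FunctionSpaces.eBMOSeminormVec (Φ i) :=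
      eBMOSeminormVec_sum_smul_le fun i _ => hΦli i
    have h₃ : ∑ i, ‖⟪b i, v⟫‖ₑ * FunctionSpaces.eBMOSeminormVec (Φ i) ≤
        ∑ i, FunctionSpaces.eBMOSeminormVec (Φ i) :=
      Finset.sum_le_sum fun i _ => mul_le_of_le_one_left' (hcoef i)
    exact h₁.trans (h₂.trans h₃)
  calc eBMOInvNormVec u₀ ≤ ∑ i, FunctionSpaces.eBMOSeminormVec (Φ i) := iSup₂_le hbound
    _ < ∞ := ENNReal.sum_lt_top.2 fun i _ => FunctionSpaces.eBMOSeminormVec_lt_top (hΦ i)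

end KochTataru

end Literature.Analysis.FluidPDE
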